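import Mathlib
import Literature.Computability.AlgebraicComplexity.ApolarityAction
import Literature.Computability.AlgebraicComplexity.LinSubst
import Literature.Computability.Complexity.OccurrenceObstructionsBIP
import Summits.ValiantsHypothesis.ValiantsHypothesis.Theorems.ValuativeGCTValuativeFlipCatalecticantHWV
import Summits.ValiantsHypothesis.ValiantsHypothesis.Theorems.ValuativeGCTValuativeFlipCatalecticantPadding

/-!
# Padding kills the corner minors with low COLUMN degree as well (transpose symmetry)

Crux `ValuativeGCT.ValuativeFlip` (stmt-ValiantsHypothesis-12624), wall-breaker axis
"explicit padded-permanent highest-weight vectors for seedRichness" (k5 gen 1, seat 3), part 3.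

Part 2 (`det_catMinorMat_eq_zero_of_pow_dvd`) kills the corner minors of the catalecticant of
`h = ℓ^p g` whose ROW degree is below `p` (column segment of `≥ 2` variables).  The catalecticant is
symmetric up to factorials — `γ! · coeff_γ(∂^ρ h) = ρ! · coeff_ρ(∂^γ h) = (ρ+γ)! · coeff_{ρ+γ} h`
(`prod_factorial_mul_coeff_apolarAction_comm`) — so the corner with rows `a`, columns `b` is, up to
the invertible diagonal factors `ρ!`, `γ!` (characteristic zero), the transpose of the corner with
rows `b`, columns `a` and the segments exchanged (`det_catMinorMat_mul_prod_eq`).  Hence the minors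
with COLUMN degree `b < p` and a ROW segment of `≥ 2` variables vanish too
(`det_catMinorMat_eq_zero_of_pow_dvd_of_lt`), in particular on `End · (X₀₀^{m-n} per_n)` for
`b < m - n` (`det_catMinorMat_paddedPer_eq_zero_of_lt`).  Together: a corner minor alive somewhere on
`End · pp` with both segments of `≥ 2` variables has `min(a, b) ≥ m - n`.
[Iarrobino–Kanev LNM 1721 §1.1; Landsberg 2017 §7.2; folklore]
-/

set_option linter.dupNamespace false

namespace Summit.ValiantsHypothesis.ValiantsHypothesis.Theorems.ValuativeFlip

open MvPolynomial
open scoped BigOperators Matrix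
open Literature.Computability.AlgebraicComplexity
open Literature.Computability.Complexity
open Literature.NumberTheory.DiophantineGeometry

noncomputable section

section Symmetry

variable {σ : Type*} {k : Type*} [Field k]

/-- The factorial of an exponent vector over a finset containing its support:
`∏_{i ∈ S} (d i)! = ∏_{i ∈ d.support} (d i)!` (`0! = 1` off the support). [folklore] -/
theorem prod_factorial_eq_prod_support (d : σ →₀ ℕ) {S : Finset σ} (hS : d.support ⊆ S) :
    ∏ i ∈ S, ((d i).factorial : k) = ∏ i ∈ d.support, ((d i).factorial : k) := by
  symm
  refine Finset.prod_subset hS fun i _ hi => ?_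
  rw [Finsupp.notMem_support_iff.mp hi, Nat.factorial_zero, Nat.cast_one]

/-- The descending-factorial factor of `coeff_apolarAction_monomial_one` over a finset containing
the support. [folklore] -/
theorem prod_descFactorial_eq_prod_support (ρ γ : σ →₀ ℕ) {S : Finset σ} (hS : ρ.support ⊆ S) :
    ∏ i ∈ S, (((ρ + γ) i).descFactorial (ρ i) : k) = ∏ i ∈ ρ.support, (((ρ + γ) i).descFactorial (ρ i) : k) := by
  symm
  refine Finset.prod_subset hS fun i _ hi => ?_
  rw [Finsupp.notMem_support_iff.mp hi, Nat.descFactorial_zero, Nat.cast_one]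

/-- **The factorial identity** `γ! · (ρ+γ)!/γ! = ρ! · (γ+ρ)!/ρ!` behind the symmetry of the
catalecticant. [folklore] -/
theorem prod_factorial_mul_prod_descFactorial_comm (ρ γ : σ →₀ ℕ) :
    (∏ i ∈ γ.support, ((γ i).factorial : k)) * ∏ i ∈ ρ.support, (((ρ + γ) i).descFactorial (ρ i) : k) =
      (∏ i ∈ ρ.support, ((ρ i).factorial : k)) * ∏ i ∈ γ.support, (((γ + ρ) i).descFactorial (γ i) : k) := by
  classical
  rw [← prod_factorial_eq_prod_support γ (Finset.subset_union_right (s₁ := ρ.support)),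
    ← prod_factorial_eq_prod_support ρ (Finset.subset_union_left (s₂ := γ.support)),
    ← prod_descFactorial_eq_prod_support ρ γ (Finset.subset_union_left (s₂ := γ.support)),
    ← prod_descFactorial_eq_prod_support γ ρ (Finset.subset_union_right (s₁ := ρ.support)),
    ← Finset.prod_mul_distrib, ← Finset.prod_mul_distrib]
  refine Finset.prod_congr rfl fun i _ => ?_
  rw [Finsupp.add_apply, Finsupp.add_apply]
  have h1 := Nat.factorial_mul_descFactorial (Nat.le_add_right (ρ i) (γ i))
  have h2 := Nat.factorial_mul_descFactorial (Nat.le_add_right (γ i) (ρ i))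
  rw [Nat.add_sub_cancel_left] at h1 h2
  have h12 : (γ i).factorial * (ρ i + γ i).descFactorial (ρ i) = (ρ i).factorial * (γ i + ρ i).descFactorial (γ i) := by
    rw [h1, h2, Nat.add_comm]
  rw [← Nat.cast_mul, ← Nat.cast_mul, h12]

variable [LinearOrder σ]

/-- **Symmetry of the catalecticant up to factorials**:
`γ! · coeff_γ(∂^ρ h) = ρ! · coeff_ρ(∂^γ h)` (both are `(ρ+γ)! · coeff_{ρ+γ} h`).
Iarrobino–Kanev §1.1. [folklore] -/
theorem prod_factorial_mul_coeff_apolarAction_comm (ρ γ : σ →₀ ℕ) (h : MvPolynomial σ k) :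
    (∏ i ∈ γ.support, ((γ i).factorial : k)) * coeff γ (apolarAction (monomial ρ (1 : k)) h) =
      (∏ i ∈ ρ.support, ((ρ i).factorial : k)) * coeff ρ (apolarAction (monomial γ (1 : k)) h) := by
  classical
  rw [coeff_apolarAction_monomial_one, coeff_apolarAction_monomial_one, add_comm γ ρ,
    mul_left_comm, mul_left_comm (∏ i ∈ ρ.support, ((ρ i).factorial : k))]
  congr 1
  have hc := prod_factorial_mul_prod_descFactorial_comm (k := k) ρ γ
  rwa [add_comm γ ρ] at hc

variable [Fintype σ]

/-- **The corner with rows `a`, columns `b` against the exchanged corner.**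
`det Cat(h)_{a,b;i₁,i₂} · ∏_{γ} γ! = ∏_{ρ} ρ! · det Cat(h)_{b,a;i₂,i₁}` (the second corner taken through
`e⁻¹`, so that both are indexed compatibly). [folklore] -/
theorem det_catMinorMat_mul_prod_eq (a b : ℕ) (i₁ i₂ : σ) (e : UpIdx σ a i₁ ≃ UpIdx σ b i₂)
    (h : MvPolynomial σ k) :
    (catMinorMat a b i₁ i₂ e h).det * ∏ r' : UpIdx σ a i₁, ∏ i ∈ (e r').vec.support, (((e r').vec i).factorial : k) =
      (∏ r : UpIdx σ a i₁, ∏ i ∈ r.vec.support, ((r.vec i).factorial : k)) *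
        (catMinorMat b a i₂ i₁ e.symm h).det := by
  classical
  set c₁ : UpIdx σ a i₁ → k := fun r => ∏ i ∈ r.vec.support, ((r.vec i).factorial : k) with hc₁
  set c₂ : UpIdx σ a i₁ → k := fun r' => ∏ i ∈ (e r').vec.support, (((e r').vec i).factorial : k) with hc₂
  -- `M · diag c₂ = diag c₁ · M'`, `M'` the transposed, reindexed exchanged corner
  have hmat : catMinorMat a b i₁ i₂ e h * Matrix.diagonal c₂ =
      Matrix.diagonal c₁ * ((catMinorMat b a i₂ i₁ e.symm h).submatrix e e)ᵀ := by
    ext r r'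
    rw [Matrix.mul_diagonal, Matrix.diagonal_mul, Matrix.transpose_apply, Matrix.submatrix_apply,
      catMinorMat_apply, catMinorMat_apply, catMat_apply, catMat_apply, Equiv.symm_apply_apply,
      mul_comm]
    exact prod_factorial_mul_coeff_apolarAction_comm r.vec (e r').vec h
  have hdet := congrArg Matrix.det hmat
  rw [Matrix.det_mul, Matrix.det_mul, Matrix.det_diagonal, Matrix.det_diagonal, Matrix.det_transpose,
    Matrix.det_submatrix_equiv_self] at hdet
  exact hdet

/-- **Low COLUMN degree**: for `h = ℓ^p g` (`ℓ` linear), column degree `b < p` and a ROW segment of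
at least two variables, the corner minor vanishes (characteristic zero). [folklore] -/
theorem det_catMinorMat_eq_zero_of_pow_dvd_of_lt [CharZero k] {ℓ h : MvPolynomial σ k}
    (hℓ : ℓ.IsHomogeneous 1) {p : ℕ} (hh : ℓ ^ p ∣ h) (a b : ℕ) (hb : b < p) (i₁ i₂ : σ)
    (h1 : 2 ≤ Fintype.card {l : σ // i₁ ≤ l}) (e : UpIdx σ a i₁ ≃ UpIdx σ b i₂) :
    (catMinorMat a b i₁ i₂ e h).det = 0 := by
  classical
  have key := det_catMinorMat_mul_prod_eq a b i₁ i₂ e h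
  rw [det_catMinorMat_eq_zero_of_pow_dvd hℓ hh b a hb i₂ i₁ h1 e.symm, mul_zero] at key
  have hne : (∏ r' : UpIdx σ a i₁, ∏ i ∈ (e r').vec.support, (((e r').vec i).factorial : k)) ≠ 0 :=
    Finset.prod_ne_zero_iff.mpr fun r' _ => Finset.prod_ne_zero_iff.mpr fun i _ => by
      exact_mod_cast Nat.factorial_ne_zero _
  exact (mul_eq_zero.mp key).resolve_right hne

end Symmetry

section Padded

/-- **Padding kills the corner minors of low column degree on `End · (X₀₀^{m-n} per_n)`**:
`b < m - n` and a row segment of at least two variables force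
`det Cat(A · pp)_{a,b;i₁,i₂} = 0` for every matrix `A`. [Landsberg 2017 §7.2; this crux; folklore] -/
theorem det_catMinorMat_paddedPer_eq_zero_of_lt (n m a b : ℕ) [NeZero m] (hb : b < m - n)
    (i₁ i₂ : MatIdx m) (h1 : 2 ≤ Fintype.card {l : MatIdx m // i₁ ≤ l})
    (e : UpIdx (MatIdx m) a i₁ ≃ UpIdx (MatIdx m) b i₂) (A : Matrix (MatIdx m) (MatIdx m) ℂ) :
    (catMinorMat a b i₁ i₂ e (linSubst (MatIdx m) ℂ A (paddedPerFormLex ℂ n m))).det = 0 := by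
  rw [paddedPerFormLex_eq, map_mul, map_pow]
  refine det_catMinorMat_eq_zero_of_pow_dvd_of_lt ?_ (dvd_mul_right _ _) a b hb i₁ i₂ h1 e
  rw [linSubst_X]
  exact IsHomogeneous.sum _ _ _ fun l _ => by
    rw [smul_eq_C_mul]; exact (isHomogeneous_X ℂ l).C_mul _

/-- **Survivors have both degrees at least the padding.**  If a corner minor of the catalecticant is
nonzero at ONE point `A · (X₀₀^{m-n} per_n)` and both segments have at least two variables, then
`m - n ≤ a` and `m - n ≤ b`. [this crux (AxisK5G1S3); folklore] -/
theorem sub_le_and_sub_le_of_det_catMinorMat_paddedPer_ne_zero (n m a b : ℕ) [NeZero m]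
    (i₁ i₂ : MatIdx m) (h1 : 2 ≤ Fintype.card {l : MatIdx m // i₁ ≤ l})
    (h2 : 2 ≤ Fintype.card {l : MatIdx m // i₂ ≤ l})
    (e : UpIdx (MatIdx m) a i₁ ≃ UpIdx (MatIdx m) b i₂) (A : Matrix (MatIdx m) (MatIdx m) ℂ)
    (hA : (catMinorMat a b i₁ i₂ e (linSubst (MatIdx m) ℂ A (paddedPerFormLex ℂ n m))).det ≠ 0) :
    m - n ≤ a ∧ m - n ≤ b := by
  refine ⟨not_lt.mp fun ha => hA ?_, not_lt.mp fun hb => hA ?_⟩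
  · exact det_catMinorMat_paddedPer_eq_zero n m a b ha i₁ i₂ h2 e A
  · exact det_catMinorMat_paddedPer_eq_zero_of_lt n m a b hb i₁ i₂ h1 e A

/-- **Beyond `m = 2n` nothing survives.**  For `a + b = m > 2n` every corner minor with both
segments of at least two variables vanishes identically on `End · (X₀₀^{m-n} per_n)`
(`min(a,b) ≥ m - n` is incompatible with `a + b = m < 2(m-n)`). [this crux; folklore] -/
theorem det_catMinorMat_paddedPer_eq_zero_of_two_mul_lt (n m a b : ℕ) [NeZero m] (hab : a + b = m)
    (h2n : 2 * n < m) (i₁ i₂ : MatIdx m) (h1 : 2 ≤ Fintype.card {l : MatIdx m // i₁ ≤ l})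
    (h2 : 2 ≤ Fintype.card {l : MatIdx m // i₂ ≤ l})
    (e : UpIdx (MatIdx m) a i₁ ≃ UpIdx (MatIdx m) b i₂) (A : Matrix (MatIdx m) (MatIdx m) ℂ) :
    (catMinorMat a b i₁ i₂ e (linSubst (MatIdx m) ℂ A (paddedPerFormLex ℂ n m))).det = 0 := by
  by_contra hA
  obtain ⟨ha, hb⟩ := sub_le_and_sub_le_of_det_catMinorMat_paddedPer_ne_zero n m a b i₁ i₂ h1 h2 e A hA
  omega

/-- **Registered form** (stub `catMinor_paddedPer_survivors` of stmt-ValiantsHypothesis-12624, one-line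
`∀` signature): a corner minor alive at one point of `End · (X₀₀^{m-n} per_n)` with both segments of
at least two variables has both degrees `≥ m - n`. [this crux; folklore] -/
theorem catMinor_paddedPer_survivors :
    ∀ (n m a b : ℕ) [NeZero m] (i₁ i₂ : MatIdx m), 2 ≤ Fintype.card {l : MatIdx m // i₁ ≤ l} → 2 ≤ Fintype.card {l : MatIdx m // i₂ ≤ l} → ∀ (e : UpIdx (MatIdx m) a i₁ ≃ UpIdx (MatIdx m) b i₂) (A : Matrix (MatIdx m) (MatIdx m) ℂ), (catMinorMat a b i₁ i₂ e (linSubst (MatIdx m) ℂ A (paddedPerFormLex ℂ n m))).det ≠ 0 → m - n ≤ a ∧ m - n ≤ b :=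
  fun n m a b _ i₁ i₂ h1 h2 e A hA =>
    sub_le_and_sub_le_of_det_catMinorMat_paddedPer_ne_zero n m a b i₁ i₂ h1 h2 e A hA

end Padded

end

end Summit.ValiantsHypothesis.ValiantsHypothesis.Theorems.ValuativeFlip
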